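import Mathlib.Analysis.SpecialFunctions.SmoothTransition
import Mathlib.Analysis.Calculus.ContDiff.Deriv
import Mathlib.MeasureTheory.Integral.IntervalIntegral.FundThmCalculus
import HarnessLib

/-!
# FunctionalMining — a smooth ramp with slope in `[0, 1]` vanishing below a threshold (cutoff tool)

Search for candidate a priori estimates; no regularity claim. Cell `pub-nsfunc`, prove seat (gen 26).
One-variable tool for step (iv) of the kernel plan for Proposition L-λ(η) at `q = 2` (the dictionary's
node `TopEigGapCoerciveTwo η`, `TopEigHeatCoerciveGap.lean`): on the top-gap class the field
`M = λ₁ · e₁ ⊗ e₁` is smooth only away from the zeros of the strain, so the assembly of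
`TopEigGapCoerciveSimple` is re-run with `λ₁` replaced by `G_δ(λ₁)`, where `G_δ` is a smooth function
of one real variable that vanishes identically on `(−∞, δ]`, has slope `G_δ' ∈ [0, 1]`, and satisfies
`s − 2δ ≤ G_δ(s) ≤ s` for `s ≥ 0`; then `δ → 0`.

CONTENT (namespace `Summit.NavierStokesRegularity.FunctionalMining.TopEig`):
* `cutStep δ s := Real.smoothTransition (s/δ − 1)` — smooth, values in `[0, 1]`, `= 0` for `s ≤ δ`,
  `= 1` for `2δ ≤ s` (`δ > 0`);
* `cutRamp δ s := ∫₀ˢ cutStep δ` — smooth (`contDiff_cutRamp`), `cutRamp' = cutStep`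
  (`hasDerivAt_cutRamp`), `cutRamp δ s = 0` for `s ≤ δ`, and for `s ≥ 0`:
  `0 ≤ cutRamp δ s ≤ s`, `s − 2δ ≤ cutRamp δ s`, whence `s − cutRamp δ s ≤ 2δ`.

[ours; folklore calculus]
-/

noncomputable section

open Set MeasureTheory intervalIntegral
open scoped ContDiff

namespace Summit.NavierStokesRegularity.FunctionalMining

namespace TopEig

/-! ## 1. The smooth step -/

/-- The smooth step `g_δ(s) = smoothTransition (s/δ − 1)`: `0` on `(−∞, δ]`, `1` on `[2δ, ∞)`.
[folklore] -/
def cutStep (δ s : ℝ) : ℝ := Real.smoothTransition (s / δ - 1)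

/-- `0 ≤ g_δ`. [folklore] -/
theorem cutStep_nonneg (δ s : ℝ) : 0 ≤ cutStep δ s := Real.smoothTransition.nonneg _

/-- `g_δ ≤ 1`. [folklore] -/
theorem cutStep_le_one (δ s : ℝ) : cutStep δ s ≤ 1 := Real.smoothTransition.le_one _

/-- `g_δ(s) = 0` for `s ≤ δ` (`δ > 0`). [folklore] -/
theorem cutStep_of_le {δ s : ℝ} (hδ : 0 < δ) (hs : s ≤ δ) : cutStep δ s = 0 := by
  unfold cutStep
  refine Real.smoothTransition.zero_of_nonpos ?_
  rw [sub_nonpos, div_le_one hδ]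
  exact hs

/-- `g_δ(s) = 1` for `2δ ≤ s` (`δ > 0`). [folklore] -/
theorem cutStep_of_ge {δ s : ℝ} (hδ : 0 < δ) (hs : 2 * δ ≤ s) : cutStep δ s = 1 := by
  unfold cutStep
  refine Real.smoothTransition.one_of_one_le ?_
  rw [le_sub_iff_add_le, le_div_iff₀ hδ]
  linarith

/-- `g_δ` is smooth. [folklore] -/
theorem contDiff_cutStep (δ : ℝ) : ContDiff ℝ ∞ (cutStep δ) :=
  Real.smoothTransition.contDiff.comp ((contDiff_id.div_const δ).sub contDiff_const)

/-- `g_δ` is continuous. [folklore] -/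
theorem continuous_cutStep (δ : ℝ) : Continuous (cutStep δ) := (contDiff_cutStep δ).continuous

/-! ## 2. The smooth ramp -/

/-- The smooth ramp `G_δ(s) = ∫₀ˢ g_δ`. [folklore] -/
def cutRamp (δ s : ℝ) : ℝ := ∫ r in (0 : ℝ)..s, cutStep δ r

/-- `G_δ' = g_δ`. [folklore] -/
theorem hasDerivAt_cutRamp (δ s : ℝ) : HasDerivAt (cutRamp δ) (cutStep δ s) s :=
  ((continuous_cutStep δ).integral_hasStrictDerivAt 0 s).hasDerivAt

/-- `deriv G_δ = g_δ`. [folklore] -/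
theorem deriv_cutRamp (δ : ℝ) : deriv (cutRamp δ) = cutStep δ :=
  funext fun s => (hasDerivAt_cutRamp δ s).deriv

/-- `G_δ` is differentiable. [folklore] -/
theorem differentiable_cutRamp (δ : ℝ) : Differentiable ℝ (cutRamp δ) :=
  fun s => (hasDerivAt_cutRamp δ s).differentiableAt

/-- `G_δ` is smooth. [folklore] -/
theorem contDiff_cutRamp (δ : ℝ) : ContDiff ℝ ∞ (cutRamp δ) := by
  rw [contDiff_infty_iff_deriv, deriv_cutRamp]
  exact ⟨differentiable_cutRamp δ, contDiff_cutStep δ⟩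

/-- `G_δ` is continuous. [folklore] -/
theorem continuous_cutRamp (δ : ℝ) : Continuous (cutRamp δ) := (contDiff_cutRamp δ).continuous

/-- `G_δ(s) = 0` for `s ≤ δ` (`δ > 0`): the integrand vanishes between `0` and `s`. [folklore] -/
theorem cutRamp_of_le {δ s : ℝ} (hδ : 0 < δ) (hs : s ≤ δ) : cutRamp δ s = 0 := by
  unfold cutRamp
  rw [integral_congr (g := fun _ => (0 : ℝ)) fun r hr => ?_, intervalIntegral.integral_zero]
  -- `r ∈ uIcc 0 s` gives `r ≤ max 0 s ≤ δ`
  have hr' : r ≤ δ := by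
    rcases le_total 0 s with h0s | hs0
    · rw [uIcc_of_le h0s] at hr; exact hr.2.trans hs
    · rw [uIcc_of_ge hs0] at hr; exact hr.2.trans hδ.le
  exact cutStep_of_le hδ hr'

/-- `0 ≤ G_δ(s)` for `0 ≤ s`. [folklore] -/
theorem cutRamp_nonneg {δ s : ℝ} (hs : 0 ≤ s) : 0 ≤ cutRamp δ s :=
  integral_nonneg hs fun r _ => cutStep_nonneg δ r

/-- `G_δ(s) ≤ s` for `0 ≤ s` (slope at most one). [folklore] -/
theorem cutRamp_le_self {δ s : ℝ} (hs : 0 ≤ s) : cutRamp δ s ≤ s := by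
  unfold cutRamp
  have h := integral_mono_on hs ((continuous_cutStep δ).intervalIntegrable 0 s)
    (intervalIntegrable_const (μ := volume) (c := (1 : ℝ))) fun r _ => cutStep_le_one δ r
  rw [intervalIntegral.integral_const, smul_eq_mul, mul_one, sub_zero] at h
  exact h

/-- `s − 2δ ≤ G_δ(s)` for `0 ≤ s` (`δ > 0`): the slope is `1` beyond `2δ`. [folklore] -/
theorem self_sub_le_cutRamp {δ s : ℝ} (hδ : 0 < δ) (hs : 0 ≤ s) : s - 2 * δ ≤ cutRamp δ s := by
  rcases le_or_gt s (2 * δ) with h | h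
  · exact (sub_nonpos.2 h).trans (cutRamp_nonneg hs)
  · -- split `∫₀ˢ = ∫₀^{2δ} + ∫_{2δ}^s`, the second one is `s − 2δ`
    have hi : ∀ a b : ℝ, IntervalIntegrable (cutStep δ) volume a b := fun a b =>
      (continuous_cutStep δ).intervalIntegrable a b
    unfold cutRamp
    rw [← integral_add_adjacent_intervals (hi 0 (2 * δ)) (hi (2 * δ) s)]
    have h1 : 0 ≤ ∫ r in (0 : ℝ)..(2 * δ), cutStep δ r :=
      integral_nonneg (by linarith) fun r _ => cutStep_nonneg δ r
    have h2 : ∫ r in (2 * δ)..s, cutStep δ r = s - 2 * δ := by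
      rw [integral_congr (g := fun _ => (1 : ℝ)) fun r hr => ?_, intervalIntegral.integral_const, smul_eq_mul,
        mul_one]
      rw [uIcc_of_le h.le] at hr
      exact cutStep_of_ge hδ hr.1
    linarith

/-- `s − G_δ(s) ≤ 2δ` for `0 ≤ s` (`δ > 0`). [folklore] -/
theorem self_sub_cutRamp_le {δ s : ℝ} (hδ : 0 < δ) (hs : 0 ≤ s) : s - cutRamp δ s ≤ 2 * δ := by
  have := self_sub_le_cutRamp hδ hs
  linarith

/-- `0 ≤ s − G_δ(s)` for `0 ≤ s`. [folklore] -/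
theorem self_sub_cutRamp_nonneg {δ s : ℝ} (hs : 0 ≤ s) : 0 ≤ s - cutRamp δ s :=
  sub_nonneg.2 (cutRamp_le_self hs)

/-- `G_δ(s)² ≤ s · G_δ(s)` for `0 ≤ s` (from `0 ≤ G_δ ≤ s`). [folklore] -/
theorem cutRamp_sq_le {δ s : ℝ} (hs : 0 ≤ s) : cutRamp δ s ^ 2 ≤ s * cutRamp δ s := by
  have h0 := cutRamp_nonneg (δ := δ) hs
  have h1 := cutRamp_le_self (δ := δ) hs
  nlinarith

/-- `g_δ(s)² ≤ g_δ(s)` (from `0 ≤ g_δ ≤ 1`). [folklore] -/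
theorem cutStep_sq_le (δ s : ℝ) : cutStep δ s ^ 2 ≤ cutStep δ s := by
  have h0 := cutStep_nonneg δ s
  have h1 := cutStep_le_one δ s
  nlinarith

/-- `G_δ` vanishes on a neighbourhood of every `s < δ`: it is eventually equal to `0` there
(`δ > 0`). [folklore] -/
theorem cutRamp_eventuallyEq_zero {δ s : ℝ} (hδ : 0 < δ) (hs : s < δ) :
    (cutRamp δ) =ᶠ[nhds s] fun _ => 0 := by
  filter_upwards [Iio_mem_nhds hs] with r hr
  exact cutRamp_of_le hδ (le_of_lt hr)

end TopEig

end Summit.NavierStokesRegularity.FunctionalMining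

end
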